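import Summits.BirchSwinnertonDyer.BirchSwinnertonDyer.Theorems.QuadraticBranchSignedControlPlusEtaR1KuriharaRows01
import Summits.BirchSwinnertonDyer.BirchSwinnertonDyer.Theorems.QuadraticBranchSignedControlPlusEtaR0KuriharaKRows02
import Summits.BirchSwinnertonDyer.BirchSwinnertonDyer.Theorems.QuadraticBranchSignedControlPlusEtaR0KuriharaKRows03
import Summits.BirchSwinnertonDyer.BirchSwinnertonDyer.Theorems.QuadraticBranchSignedControlPlusEtaR0KuriharaKRows04
import Summits.BirchSwinnertonDyer.BirchSwinnertonDyer.Theorems.QuadraticBranchSignedControlPlusEtaR0KuriharaKRows05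
import Summits.BirchSwinnertonDyer.BirchSwinnertonDyer.Theorems.QuadraticBranchSignedControlPlusEtaR1KuriharaLambdaRows06
import Literature.NumberTheory.EllipticCurves.LocalTorsionSupersingularTwistProofs
import HarnessLib

/-!
# Route `QuadraticBranchSignedControl` (rung K8, cell `bsd-potss`), crux `PlusEtaLowerInclusion`
# (item stmt-BirchSwinnertonDyer-19601): the Kurihara-road records with the local binder
# `ht0 : #W(ℚ_p)[p] = 1` DISCHARGED IN THE KERNEL — part 1: bookkeeping, the road by name, the 4 RANK-ONE
# records (a `--supports` file; seat `bsd-potss-k8eta-c1`, gen 7)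

WHAT. Every Kurihara-road record of the crux landed by this seat's gens 6 (`…PlusEtaR1KuriharaRows01`,
`…PlusEtaR0KuriharaKRows02–05`, `…PlusEtaR1KuriharaLambdaRows06`: 17 rows — the 2 Tamagawa-free
height-defect rank-one rows, the 13 Tamagawa-free rank-zero rows, 2 λ-rows) displays, next to the named
inputs `hKim` (Kim 2026 Thm. 1.11 (1) ⟹ (3) read at `η`) and Cremona's Manin data (`h300`/`h500`) and
the data binders `hopt`/`hδ`, the LOCAL binder
`ht0 : Nat.card {Q ∈ W(ℚ_p) // p • Q = O} = 1` — Thm. 1.11's hypothesis `E(ℚ_p)[p] = 0` for the additive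
partner `E := W` — "automatic in theory (potentially good supersingular, `e = 2 < p − 1`) but not
kernel-certifiable by the tree's `ψ_p` certificate on the singular residue disc" (gen 6 memo v3 §A).
The new Literature theorem `natCard_localPTorsion_eq_one_of_twist_of_supersingular`
(`Literature/NumberTheory/EllipticCurves/LocalTorsionSupersingularTwistProofs.lean`, this seat: a
`ℚ_p`-rational `p`-torsion abscissa of `W` would transport to a `ℚ_p`-rational root of `ψ_p(V)`, whose
Newton polygon at a supersingular `p` is one segment of slope `2/(p² − 1)`) makes it a THEOREM for every
model `W` of a quadratic twist of a good supersingular curve. THIS FILE (part 1) and its sibling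
`…PlusEtaKuriharaRecordsLocalTorsion02` (part 2: the 13 rank-zero records) re-issue all 17 records WITHOUT `ht0`:

* §1 `etaPair_of_localTorsion` — bookkeeping: the binder is discharged INSIDE the two node conclusions
  (which carry `p ≠ 2`, `V.HasGoodReductionAtPrime p`, `V.frobeniusTrace p = 0` as their own binders), so a
  record stated «for every model `V` of `W^{(d)}`, no `V`-side certificate» keeps exactly that shape;
  `etaPair_of_thm111_of_kuriharaUnit` — the Kurihara road BY NAME (gen 6's
  `PlusEtaR1Kurihara.etaPair_of_thm111_of_kuriharaUnit`) with `ht0` removed;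
* §2 the 17 records `etaPair_r{0,1}_kur[K]_v<label>_<p>` of namespace `…Theorems.PlusEtaKuriharaT0`, each
  `=` the landed record of the same name fed with the discharged binder. Trust base per record AFTER this
  file: {`hKim` (p534181), Cremona's Manin datum (`h300`/`h500`), `hopt`, `hδ` (unit Kurihara number:
  kit j279367 / j260432 / j261654 / j283615, two engines on the r1 rows)} — `ht0` is gone.

HONEST LABEL: per-row instances CONDITIONAL on the named fact `hKim` and the displayed `hopt`/`hδ`; the
class-wide crux 19601 stays OPEN (Kato's lower inclusion for the additive twist, in print for no non-CM
`V`); nothing is booked; `BSD(W, p)` is claimed for no row; BSD is not proved by any of this.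
TALLY of the 40 tower-onto census rows (unchanged): r0 19/19, r1 20/21, residue `69150v1`.

References: [Kim2022StructureSelmer] Thm. 1.11 (PDF p. 8), Prop. 3.2 (PDF p. 15), §6 (PDF p. 31);
[Kobayashi2003] §4 (p. 8), proof of Thm. 7.4 (p. 13); [Serre1972] §1.11 Prop. 12.
-/

set_option autoImplicit false
-- sibling precedent (`…PlusEtaR1KuriharaRows01.lean`): the directory name repeats the summit name
set_option linter.dupNamespace false

noncomputable section

open scoped Classical

namespace Summit.BirchSwinnertonDyer.BirchSwinnertonDyer.Theorems.PlusEtaKuriharaT0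

open CongruenceSubgroup WeierstrassCurve Field Literature.NumberTheory.EllipticCurves
  Literature.NumberTheory.EllipticCurves.ModularForms
  Literature.NumberTheory.GaloisRepresentations
  Literature.NumberTheory.EllipticCurves.Rank1Residual
  Literature.NumberTheory.EllipticCurves.Rank1Residual.Typed
  Summit.BirchSwinnertonDyer.Rank1Residual
  Summit.BirchSwinnertonDyer.BirchSwinnertonDyer.Theorems

open Summit.BirchSwinnertonDyer.Rank1Residual.Additive hiding EtaSignedSelmerDualData
  IsQuadraticBranchPlusLFunction IsQuadraticBranchMinusLFunction

/-! ## §1 Discharging `ht0` inside the node conclusions; the road by name without `ht0` -/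

/-- **Bookkeeping: the local binder is discharged INSIDE the nodes.** If `C • W^{(d)} = V` (`d ≠ 0`,
`W` elliptic) and the pair conclusion «(E⁺_η) at `(V, p)` ∧ (tower onto → (C1⁺_η))» holds GIVEN
`#W(ℚ_p)[p] = 1`, then it holds outright: both nodes quantify over `p ≠ 2`,
`V.HasGoodReductionAtPrime p`, `V.frobeniusTrace p = 0`, under which
`natCard_localPTorsion_eq_one_of_twist_of_supersingular` supplies the binder.
[cite: Kim2022StructureSelmer, Prop. 3.2 (PDF p. 15)] -/
theorem etaPair_of_localTorsion {V : WeierstrassCurve ℚ} [V.IsElliptic] [V.IsGloballyMinimal]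
    {p : ℕ} [Fact p.Prime] (W : WeierstrassCurve ℚ) [W.IsElliptic] (C : VariableChange ℚ) {d : ℚ}
    (hd : d ≠ 0) (hCV : C • W.quadraticTwist d = V)
    (h : Nat.card {Q : (W.baseChange ℚ_[p]).toAffine.Point // (p : ℕ) • Q = 0} = 1 →
      QuadraticBranchPlusEtaLowerInclusionAt V p ∧
        ((∀ m : ℕ, V.HasSurjectiveModNGaloisRep (p ^ m : ℕ)) →
          QuadraticBranchPlusEtaMainConjectureAt V p)) :
    QuadraticBranchPlusEtaLowerInclusionAt V p ∧
      ((∀ m : ℕ, V.HasSurjectiveModNGaloisRep (p ^ m : ℕ)) →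
        QuadraticBranchPlusEtaMainConjectureAt V p) := by
  refine ⟨?_, fun htower ↦ ?_⟩
  · intro K₀ _ _ _ _ ηq hηK hη1 N _ f hp2 hgood hap hf ϖ hϖ Lη hL κ γ hκ hγ hγK hγc Dd
    exact (h (natCard_localPTorsion_eq_one_of_twist_of_supersingular p W C hp2
      (V.not_dvd_minimalDiscriminantInt_of_hasGoodReductionAtPrime' p hgood)
      (by rw [hap]; exact dvd_zero _) hd hCV)).1
      K₀ ηq hηK hη1 hp2 hgood hap hf ϖ hϖ Lη hL κ γ hκ hγ hγK hγc Dd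
  · intro K₀ _ _ _ _ ηq hηK hη1 N _ f hp2 hgood hap hf ϖ hϖ Lη hL κ γ hκ hγ hγK hγc Dd
    exact (h (natCard_localPTorsion_eq_one_of_twist_of_supersingular p W C hp2
      (V.not_dvd_minimalDiscriminantInt_of_hasGoodReductionAtPrime' p hgood)
      (by rw [hap]; exact dvd_zero _) hd hCV)).2 htower
      K₀ ηq hηK hη1 hp2 hgood hap hf ϖ hϖ Lη hL κ γ hκ hγ hγK hγc Dd

/-- **THE KURIHARA ROAD BY NAME, WITHOUT `ht0`**: `Kim2026.thm111_etaEisensteinInclusion_of_kuriharaNumber_ne_zero`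
(hypothesis `hKim`) + one globally minimal partner `W` of `V` (`C • W^{(p*)} = V`) with `5 ≤ p`,
`ρ̄_{W,p}` onto, `p ∤ ∏ c_ℓ(W)`, a modular parametrisation datum with `p ∤ c_D` and the period transfer,
a level `n ∈ 𝒩₁` with the cyclicity flag and a unit Kurihara number ⟹ (E⁺_η) at `(V, p)`, and (C1⁺_η)
under the onto tower. Gen 6's `PlusEtaR1Kurihara.etaPair_of_thm111_of_kuriharaUnit` with its binder
`ht0 : #W(ℚ_p)[p] = 1` DISCHARGED (`etaPair_of_localTorsion`). CONDITIONAL on `hKim`; closes nothing.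
[cite: Kim2022StructureSelmer, Thm. 1.11 (PDF p. 8), Prop. 3.2 (PDF p. 15) and §6 (PDF p. 31)]
[cite: Kobayashi2003, proof of Thm. 7.4 (p. 13), §4 (p. 8)] -/
theorem etaPair_of_thm111_of_kuriharaUnit {V : WeierstrassCurve ℚ} [V.IsElliptic] [V.IsGloballyMinimal]
    {p : ℕ} [Fact p.Prime] (hKim : Kim2026.thm111_etaEisensteinInclusion_of_kuriharaNumber_ne_zero)
    (W : WeierstrassCurve ℚ) [W.IsElliptic] [W.IsGloballyMinimal] (C : VariableChange ℚ)
    (hCV : C • W.quadraticTwist ((-1) ^ (p / 2) * p) = V) (h5 : 5 ≤ p)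
    (hsurj : W.HasSurjectiveModNGaloisRep p) (htam : ¬ p ∣ W.tamagawaProduct)
    {NW : ℕ} [NeZero NW] (D : ModularParametrizationData W NW) (hc : ¬ (p : ℤ) ∣ D.maninConstant)
    (hper : ∃ u : ℚ, ‖(u : ℚ_[p])‖ = 1 ∧ W.realPeriodRat = u * plusPeriod D.f)
    (n : ℕ) [NeZero n] (hn : Kato.IsKolyvaginProduct W p 1 n)
    (hcyc : ∀ (ℓ : ℕ) [Fact ℓ.Prime], ℓ ∣ n →
      Nat.card {P : ((WeierstrassCurve.integralModelInt W).map
          (Int.castRingHom (ZMod ℓ))).toAffine.Point // p • P = 0} ≤ p)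
    (ψ : (ℓ : ℕ) → (ZMod ℓ)ˣ →* Multiplicative (ZMod p))
    (hψ : ∀ ℓ ∈ n.primeFactors, Function.Surjective (ψ ℓ)) (hδ : kuriharaNumber D.f p n ψ ≠ 0) :
    QuadraticBranchPlusEtaLowerInclusionAt V p ∧
      ((∀ m : ℕ, V.HasSurjectiveModNGaloisRep (p ^ m : ℕ)) →
        QuadraticBranchPlusEtaMainConjectureAt V p) :=
  etaPair_of_localTorsion W C
    (mul_ne_zero (pow_ne_zero _ (by norm_num))
      (by exact_mod_cast (Fact.out : p.Prime).ne_zero)) hCV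
    fun ht0 ↦ PlusEtaR1Kurihara.etaPair_of_thm111_of_kuriharaUnit hKim W C hCV h5 hsurj ht0 htam D hc
      hper n hn hcyc ψ hψ hδ

/-! ## §2 The rank-one records (height-defect rows `232050cw1`, `418950b1`; λ-rows `374850mx1`, `387450ei1`), `ht0` discharged -/

/-- **Record r1 height-defect row `232050cw1` (ℓ = 41), `ht0` DISCHARGED**: the landed `PlusEtaR1Kurihara.etaPair_r1_kur_v232050cw1_5` with its local binder
`ht0 : #W(ℚ_5)[5] = 1` supplied by `natCard_localPTorsion_eq_one_of_twist_of_supersingular` inside the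
nodes; trust base now {`hKim`, `h300`, `hopt`, `hδ`}. For EVERY model `V` of `W^{(5)}`: (E⁺_η) at `5`,
(C1⁺_η) under the onto tower. CONDITIONAL; per-row instance; nothing booked; `BSD(W,5)` not claimed.
[cite: Kim2022StructureSelmer, Thm. 1.11 (PDF p. 8), Prop. 3.2 (PDF p. 15)] [cite: Kobayashi2003, §4 (p. 8)] -/
theorem etaPair_r1_kur_v232050cw1_5
    (hKim : Kim2026.thm111_etaEisensteinInclusion_of_kuriharaNumber_ne_zero)
    (h300 : cremona_abs_maninConstant_eq_one_of_level_le_300000)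
    (W : WeierstrassCurve ℚ) (hW : W = ⟨1, 0, 1, -2942076, -4775813702⟩)
    (D : ModularParametrizationData W 232050)
    (hopt : ∀ z ∈ D.L.lattice, ∃ w ∈ periodLattice D.f, z = D.c * w)
    (hδ : ∃ ψ : (ℓ : ℕ) → (ZMod ℓ)ˣ →* Multiplicative (ZMod 5),
      (∀ ℓ ∈ (41 : ℕ).primeFactors, Function.Surjective (ψ ℓ)) ∧ kuriharaNumber D.f 5 (41) ψ ≠ 0)
    (V : WeierstrassCurve ℚ) [V.IsElliptic] [V.IsGloballyMinimal] [hp : Fact (5 : ℕ).Prime]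
    (C : VariableChange ℚ) (hCV : C • W.quadraticTwist 5 = V) :
    QuadraticBranchPlusEtaLowerInclusionAt V 5 ∧
      ((∀ m : ℕ, V.HasSurjectiveModNGaloisRep (5 ^ m : ℕ)) → QuadraticBranchPlusEtaMainConjectureAt V 5) := by
  haveI : W.IsElliptic := hW ▸ PlusEtaR1Kurihara.isElliptic_v232050cw1
  exact etaPair_of_localTorsion W C (by norm_num) hCV fun ht0 ↦
    PlusEtaR1Kurihara.etaPair_r1_kur_v232050cw1_5 hKim h300 W hW D hopt ht0 hδ V C hCV

/-- **Record r1 height-defect row `418950b1` (ℓ = 601), `ht0` DISCHARGED**: the landed `PlusEtaR1Kurihara.etaPair_r1_kur_v418950b1_5` with its local binder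
`ht0 : #W(ℚ_5)[5] = 1` supplied by `natCard_localPTorsion_eq_one_of_twist_of_supersingular` inside the
nodes; trust base now {`hKim`, `h500`, `hopt`, `hδ`}. For EVERY model `V` of `W^{(5)}`: (E⁺_η) at `5`,
(C1⁺_η) under the onto tower. CONDITIONAL; per-row instance; nothing booked; `BSD(W,5)` not claimed.
[cite: Kim2022StructureSelmer, Thm. 1.11 (PDF p. 8), Prop. 3.2 (PDF p. 15)] [cite: Kobayashi2003, §4 (p. 8)] -/
theorem etaPair_r1_kur_v418950b1_5
    (hKim : Kim2026.thm111_etaEisensteinInclusion_of_kuriharaNumber_ne_zero)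
    (h500 : cremona_abs_maninConstant_eq_one_of_level_lt_500000)
    (W : WeierstrassCurve ℚ) (hW : W = ⟨1, -1, 0, -86000742, 306993890916⟩)
    (D : ModularParametrizationData W 418950)
    (hopt : ∀ z ∈ D.L.lattice, ∃ w ∈ periodLattice D.f, z = D.c * w)
    (hδ : ∃ ψ : (ℓ : ℕ) → (ZMod ℓ)ˣ →* Multiplicative (ZMod 5),
      (∀ ℓ ∈ (601 : ℕ).primeFactors, Function.Surjective (ψ ℓ)) ∧ kuriharaNumber D.f 5 (601) ψ ≠ 0)
    (V : WeierstrassCurve ℚ) [V.IsElliptic] [V.IsGloballyMinimal] [hp : Fact (5 : ℕ).Prime]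
    (C : VariableChange ℚ) (hCV : C • W.quadraticTwist 5 = V) :
    QuadraticBranchPlusEtaLowerInclusionAt V 5 ∧
      ((∀ m : ℕ, V.HasSurjectiveModNGaloisRep (5 ^ m : ℕ)) → QuadraticBranchPlusEtaMainConjectureAt V 5) := by
  haveI : W.IsElliptic := hW ▸ PlusEtaR1Kurihara.isElliptic_v418950b1
  exact etaPair_of_localTorsion W C (by norm_num) hCV fun ht0 ↦
    PlusEtaR1Kurihara.etaPair_r1_kur_v418950b1_5 hKim h500 W hW D hopt ht0 hδ V C hCV

/-- **Record r1 λ-row `374850mx1` (ℓ = 151), `ht0` DISCHARGED**: the landed `PlusEtaR1KuriharaLambda.etaPair_r1_kur_v374850mx1_5` with its local binder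
`ht0 : #W(ℚ_5)[5] = 1` supplied by `natCard_localPTorsion_eq_one_of_twist_of_supersingular` inside the
nodes; trust base now {`hKim`, `h500`, `hopt`, `hδ`}. For EVERY model `V` of `W^{(5)}`: (E⁺_η) at `5`,
(C1⁺_η) under the onto tower. CONDITIONAL; per-row instance; nothing booked; `BSD(W,5)` not claimed.
[cite: Kim2022StructureSelmer, Thm. 1.11 (PDF p. 8), Prop. 3.2 (PDF p. 15)] [cite: Kobayashi2003, §4 (p. 8)] -/
theorem etaPair_r1_kur_v374850mx1_5
    (hKim : Kim2026.thm111_etaEisensteinInclusion_of_kuriharaNumber_ne_zero)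
    (h500 : cremona_abs_maninConstant_eq_one_of_level_lt_500000)
    (W : WeierstrassCurve ℚ) (hW : W = ⟨1, -1, 1, -198680, -33884553⟩)
    (D : ModularParametrizationData W 374850)
    (hopt : ∀ z ∈ D.L.lattice, ∃ w ∈ periodLattice D.f, z = D.c * w)
    (hδ : ∃ ψ : (ℓ : ℕ) → (ZMod ℓ)ˣ →* Multiplicative (ZMod 5),
      (∀ ℓ ∈ (151 : ℕ).primeFactors, Function.Surjective (ψ ℓ)) ∧ kuriharaNumber D.f 5 (151) ψ ≠ 0)
    (V : WeierstrassCurve ℚ) [V.IsElliptic] [V.IsGloballyMinimal] [hp : Fact (5 : ℕ).Prime]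
    (C : VariableChange ℚ) (hCV : C • W.quadraticTwist 5 = V) :
    QuadraticBranchPlusEtaLowerInclusionAt V 5 ∧
      ((∀ m : ℕ, V.HasSurjectiveModNGaloisRep (5 ^ m : ℕ)) → QuadraticBranchPlusEtaMainConjectureAt V 5) := by
  haveI : W.IsElliptic := hW ▸ PlusEtaR1KuriharaLambda.isElliptic_v374850mx1
  exact etaPair_of_localTorsion W C (by norm_num) hCV fun ht0 ↦
    PlusEtaR1KuriharaLambda.etaPair_r1_kur_v374850mx1_5 hKim h500 W hW D hopt ht0 hδ V C hCV

/-- **Record r1 λ-row `387450ei1` (ℓ = 11), `ht0` DISCHARGED**: the landed `PlusEtaR1KuriharaLambda.etaPair_r1_kur_v387450ei1_5` with its local binder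
`ht0 : #W(ℚ_5)[5] = 1` supplied by `natCard_localPTorsion_eq_one_of_twist_of_supersingular` inside the
nodes; trust base now {`hKim`, `h500`, `hopt`, `hδ`}. For EVERY model `V` of `W^{(5)}`: (E⁺_η) at `5`,
(C1⁺_η) under the onto tower. CONDITIONAL; per-row instance; nothing booked; `BSD(W,5)` not claimed.
[cite: Kim2022StructureSelmer, Thm. 1.11 (PDF p. 8), Prop. 3.2 (PDF p. 15)] [cite: Kobayashi2003, §4 (p. 8)] -/
theorem etaPair_r1_kur_v387450ei1_5
    (hKim : Kim2026.thm111_etaEisensteinInclusion_of_kuriharaNumber_ne_zero)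
    (h500 : cremona_abs_maninConstant_eq_one_of_level_lt_500000)
    (W : WeierstrassCurve ℚ) (hW : W = ⟨1, -1, 1, 9070, -2700053⟩)
    (D : ModularParametrizationData W 387450)
    (hopt : ∀ z ∈ D.L.lattice, ∃ w ∈ periodLattice D.f, z = D.c * w)
    (hδ : ∃ ψ : (ℓ : ℕ) → (ZMod ℓ)ˣ →* Multiplicative (ZMod 5),
      (∀ ℓ ∈ (11 : ℕ).primeFactors, Function.Surjective (ψ ℓ)) ∧ kuriharaNumber D.f 5 (11) ψ ≠ 0)
    (V : WeierstrassCurve ℚ) [V.IsElliptic] [V.IsGloballyMinimal] [hp : Fact (5 : ℕ).Prime]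
    (C : VariableChange ℚ) (hCV : C • W.quadraticTwist 5 = V) :
    QuadraticBranchPlusEtaLowerInclusionAt V 5 ∧
      ((∀ m : ℕ, V.HasSurjectiveModNGaloisRep (5 ^ m : ℕ)) → QuadraticBranchPlusEtaMainConjectureAt V 5) := by
  haveI : W.IsElliptic := hW ▸ PlusEtaR1KuriharaLambda.isElliptic_v387450ei1
  exact etaPair_of_localTorsion W C (by norm_num) hCV fun ht0 ↦
    PlusEtaR1KuriharaLambda.etaPair_r1_kur_v387450ei1_5 hKim h500 W hW D hopt ht0 hδ V C hCV

end Summit.BirchSwinnertonDyer.BirchSwinnertonDyer.Theorems.PlusEtaKuriharaT0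

end
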